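import Literature.NumberTheory.ConnesConsani2021.ArchKernelSigmaTM
import Literature.NumberTheory.ConnesConsani2021.ArchKernelSigmaTaylor
import HarnessLib

/-!
# K3 read-back: the Taylor models `sigmaTM k` ENCLOSE `2ẽ·Re τ_c(v_k + w)` on `|w| ≤ hQ`

RH-FREE (label, line 1): soundness of the kernel data module `ArchKernelSigmaTM` (seat cc-eng-1 g2,
`ArchCertSigma.*`, evaluated once by `decide +kernel`) against the analytic Taylor bound of seat t12
(`ArchKernelSigmaTaylor`: `SpectralCert.abs_re_frameKernel_sub_taylor_le`).  Nothing here mentions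
`ζ` or RH; nothing here bears on the truth of RH.  bears_on (cell rh-crit, corpus C1): route
«ConnesConsaniSemilocal» item K3 `WindowSpectralBound` (stmt 19306), the σ-side of the per-panel
hypothesis `hM` of `section6_enclosures_of_tier2` (`ArchKernelL1Assembly.lean`).

Main theorems: `tmem_sigmaTM (k : ℕ) : TMem S hQ (fun w ↦ 2ẽ · Re τ_c((2k+1)·log 2/128 + w)) (sigmaTM k)`
with `2ẽ = twoEtNum/twoEtDen`, `τ_c = frameKernel (−log 2/2) (log 2/2) N c`; `tmem_sigmaTM_et` (the frame's
`2·(et:ℚ)` form, `et = 22996475683870528/10¹⁵`) and `tmem_sigmaTM_spec` (`∀ k < 64`, `N = 100` literal) —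
the (σ-sound) row of the cell's Tier-2 SPEC (cc/drafts/cc-iso-TIER2-SPEC.md §2; cc-lead R120 (2)).
Ingredients: `mem_sumMI`, `mem_trigAt[_mul]` (the 256 `cisPt` boxes, exact rational angles, reduction
mod 256), `mem_factor`/`mem_sigmaCoef` (coefficients = t12's explicit Taylor coefficients times `2ẽ`),
`remainder_le_remI`, and the generic `tmem_of_taylor_bound` (remainder folded into coefficient 0).

Source: A. Connes, C. Consani, Selecta Math. 27 (2021) 77 = arXiv:2006.13771 [bib `ConnesConsani2021`],
§6.4 display (opkf1), Fact 6.1, Lemma 6.3 p. 24 (the kernel `τ` and the computer estimate `‖τ − ϖ‖₁ ≤ ε₁`).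

WHAT THIS FILE IS NOT: a certificate of (E-a), or anything about RH.
-/

noncomputable section

open Real Set Finset

namespace Literature.NumberTheory.ConnesConsani2021.ArchCertSigma

open Literature.Analysis.ValidatedNumerics.NumericsMP Literature.Analysis.ValidatedNumerics.PolyMP
open Literature.NumberTheory.ConnesConsani2021.SpectralCert

/-! ## §0 Unpacking `sigmaCheck` -/

/-- The conjuncts of `sigmaCheck` that the read-back uses. [cite: ConnesConsani2021, §6.4 display (opkf1) / Fact 6.1 p. 24] -/
theorem checks : cisAllSome = true ∧ ((MI.ofInt S 1).divPos S logTwoI).isSome = true ∧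
    0 < invL.lo ∧ 0 ≤ remI := by
  have h := sigmaCheck_eq_true
  unfold sigmaCheck at h
  simp only [Bool.and_eq_true, decide_eq_true_eq] at h
  obtain ⟨⟨⟨⟨⟨⟨h1, h2⟩, h3⟩, h4⟩, -⟩, -⟩, -⟩ := h
  exact ⟨h1, h2, h3, h4⟩

/-! ## §1 Sums in `MI` -/

/-- `sumMI` encloses the corresponding real sum. [cite: ConnesConsani2021, §6.4 display (opkf1) p. 24] -/
theorem mem_sumMI {F : ℕ → MI} {f : ℕ → ℝ} :
    ∀ n : ℕ, (∀ i < n, MI.mem S (f i) (F i)) → MI.mem S (∑ i ∈ range n, f i) (sumMI F n)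
  | 0, _ => by simpa [sumMI] using MI.mem_ofInt S 0
  | n + 1, h => by
      rw [sum_range_succ]
      exact MI.mem_add (mem_sumMI n fun i hi ↦ h i (by omega)) (h n (by omega))

/-! ## §2 The trigonometric table -/

/-- `angle r ∋ πr/128`. [cite: ConnesConsani2021, §6.4 display (opkf1) p. 24] -/
theorem mem_angle (r : ℕ) : MI.mem S (π * r / 128) (angle r) := by
  have h := MI.mem_divNat (MI.mem_mulInt mem_piI (r : ℤ)) (n := 128) (by norm_num)
  simpa [angle] using h

/-- For `r < 256` the `cisPt` evaluation succeeded and `cisAt r` is its value. [cite: ConnesConsani2021, §6.4 display (opkf1) p. 24] -/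
theorem cisPt_angle_eq {r : ℕ} (hr : r < 256) : cisPt S 40 3 (angle r) = some (cisAt r) := by
  have h := checks.1
  unfold cisAllSome at h
  rw [List.all_eq_true] at h
  have hr' := h r (List.mem_range.2 hr)
  obtain ⟨Y, hY⟩ := Option.isSome_iff_exists.1 hr'
  have : cisAt r = Y := by simp [cisAt, hY]
  rw [this]; exact hY

/-- `cos(πr/128) ∈ (cisAt r).re`, `sin(πr/128) ∈ (cisAt r).im` (`r < 256`). [cite: ConnesConsani2021, §6.4 display (opkf1) p. 24] -/
theorem mem_cos_sin_cisAt {r : ℕ} (hr : r < 256) :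
    MI.mem S (Real.cos (π * r / 128)) (cisAt r).re ∧ MI.mem S (Real.sin (π * r / 128)) (cisAt r).im :=
  ⟨mem_cos_of_cisPt S_pos (cisPt_angle_eq hr) (mem_angle r),
    mem_sin_of_cisPt S_pos (cisPt_angle_eq hr) (mem_angle r)⟩

/-- The table lookup is `cisAt`. [cite: ConnesConsani2021, §6.4 display (opkf1) p. 24] -/
theorem cisTab_getD {r : ℕ} (hr : r < 256) (d : MC) : cisTab.getD r d = cisAt r := by
  unfold cisTab
  rw [List.getD_eq_getElem?_getD, List.getElem?_map, List.getElem?_range hr]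
  rfl

/-- **`trigAt r j ∋ cos^{(j)}(πr/128)`** (`r < 256`). [cite: ConnesConsani2021, §6.4 display (opkf1) p. 24] -/
theorem mem_trigAt {r : ℕ} (hr : r < 256) (j : ℕ) :
    MI.mem S (iteratedDeriv j Real.cos (π * r / 128)) (trigAt r j) := by
  obtain ⟨hc, hs⟩ := mem_cos_sin_cisAt hr
  rw [iteratedDeriv_cos_eq_cos_add]
  have hj : j = 4 * (j / 4) + j % 4 := (Nat.div_add_mod j 4).symm
  have hmod : j % 4 < 4 := Nat.mod_lt _ (by norm_num)
  -- reduce `cos(x + jπ/2)` to one of `cos, −sin, −cos, sin`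
  have key : Real.cos (π * r / 128 + j * (π / 2))
      = Real.cos (π * r / 128 + (j % 4 : ℕ) * (π / 2)) := by
    conv_lhs => rw [hj]
    push_cast
    rw [show π * r / 128 + (4 * ((j / 4 : ℕ) : ℝ) + ((j % 4 : ℕ) : ℝ)) * (π / 2)
        = (π * r / 128 + ((j % 4 : ℕ) : ℝ) * (π / 2)) + ((j / 4 : ℕ) : ℝ) * (2 * π) by ring,
      Real.cos_add_nat_mul_two_pi]
  rw [key]
  unfold trigAt
  simp only [cisTab_getD hr]
  interval_cases hm : j % 4
  · simpa using hc
  · simp only [Nat.cast_one, one_mul, Real.cos_add_pi_div_two]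
    exact MI.mem_neg hs
  · have e : Real.cos (π * r / 128 + ((2 : ℕ) : ℝ) * (π / 2)) = -Real.cos (π * r / 128) := by
      rw [show ((2 : ℕ) : ℝ) * (π / 2) = π by push_cast; ring, Real.cos_add_pi]
    rw [e]; exact MI.mem_neg hc
  · have e : Real.cos (π * r / 128 + ((3 : ℕ) : ℝ) * (π / 2)) = Real.sin (π * r / 128) := by
      rw [show ((3 : ℕ) : ℝ) * (π / 2) = π / 2 + π by push_cast; ring, ← add_assoc,
        Real.cos_add_pi, Real.cos_add_pi_div_two, neg_neg]
    rw [e]; exact hs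

/-- Angle reduction: `cos^{(j)}(πN/128) = cos^{(j)}(π(N mod 256)/128)`. [cite: ConnesConsani2021, §6.4 display (opkf1) p. 24] -/
theorem iteratedDeriv_cos_angle_mod (N j : ℕ) :
    iteratedDeriv j Real.cos (π * N / 128) = iteratedDeriv j Real.cos (π * (N % 256 : ℕ) / 128) := by
  rw [iteratedDeriv_cos_eq_cos_add, iteratedDeriv_cos_eq_cos_add]
  have hN : (N : ℝ) = 256 * ((N / 256 : ℕ) : ℝ) + ((N % 256 : ℕ) : ℝ) := by
    exact_mod_cast (Nat.div_add_mod N 256).symm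
  rw [hN, show π * (256 * ((N / 256 : ℕ) : ℝ) + ((N % 256 : ℕ) : ℝ)) / 128 + j * (π / 2)
      = (π * ((N % 256 : ℕ) : ℝ) / 128 + j * (π / 2)) + ((N / 256 : ℕ) : ℝ) * (2 * π) by ring,
    Real.cos_add_nat_mul_two_pi]

/-- **`trigAt ((n(2k+1)) mod 256) j ∋ cos^{(j)}(πn(2k+1)/128)`** — the phases actually used.
[cite: ConnesConsani2021, §6.4 display (opkf1) p. 24] -/
theorem mem_trigAt_mul (n k j : ℕ) :
    MI.mem S (iteratedDeriv j Real.cos (π * ((n * (2 * k + 1) : ℕ) : ℝ) / 128))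
      (trigAt ((n * (2 * k + 1)) % 256) j) := by
  rw [iteratedDeriv_cos_angle_mod]
  exact mem_trigAt (Nat.mod_lt _ (by norm_num)) j

/-! ## §3 The scalar factors `1/L`, `2ẽ/L`, `(π/L)^j`, `factor j` -/

/-- `invL ∋ 1/log 2`. [cite: ConnesConsani2021, §6.4 display (opkf1) p. 24] -/
theorem mem_invL : MI.mem S (Real.log 2)⁻¹ invL := by
  obtain ⟨K, hK⟩ := Option.isSome_iff_exists.1 checks.2.1
  have e : invL = K := by simp [invL, hK]
  rw [e, inv_eq_one_div]
  have h := MI.mem_divPos S_pos hK (MI.mem_ofInt S 1) mem_logTwoI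
  simpa using h

/-- `twoEtOverL ∋ 2ẽ/log 2`. [cite: ConnesConsani2021, §6.4 Fact 6.1 p. 24] -/
theorem mem_twoEtOverL : MI.mem S ((twoEtNum : ℝ) / twoEtDen * (Real.log 2)⁻¹) twoEtOverL :=
  MI.mem_mul S_pos (MI.mem_ofFrac S twoEtNum (by unfold twoEtDen; positivity)) mem_invL

/-- `piOverL ∋ π/log 2`. [cite: ConnesConsani2021, §6.4 display (opkf1) p. 24] -/
theorem mem_piOverL : MI.mem S (π * (Real.log 2)⁻¹) piOverL :=
  MI.mem_mul S_pos mem_piI mem_invL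

/-- `powPiL j ∋ (π/log 2)^j`. [cite: ConnesConsani2021, §6.4 display (opkf1) p. 24] -/
theorem mem_powPiL : ∀ j : ℕ, MI.mem S ((π * (Real.log 2)⁻¹) ^ j) (powPiL j)
  | 0 => by simpa [powPiL] using MI.mem_ofInt S 1
  | j + 1 => by
      rw [pow_succ]
      exact MI.mem_mul S_pos (mem_powPiL j) mem_piOverL

/-- `factor j ∋ (2ẽ/L)(π/L)^j/j!`. [cite: ConnesConsani2021, §6.4 Fact 6.1 p. 24] -/
theorem mem_factor (j : ℕ) :
    MI.mem S ((twoEtNum : ℝ) / twoEtDen * (Real.log 2)⁻¹ * (π * (Real.log 2)⁻¹) ^ j / (j.factorial : ℕ))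
      (factor j) :=
  MI.mem_divNat (MI.mem_mul S_pos mem_twoEtOverL (mem_powPiL j)) (Nat.factorial_pos j)

/-! ## §4 The coefficients `P_n = 2³² c_n` -/

/-- `2³²·c_n = P_n` for `n ≤ 100`. [cite: ConnesConsani2021, §6.4 display (opkf1) p. 24] -/
theorem c_mul_eq_Pn {n : ℕ} (hn : n < 101) : CertAF.c n * 2 ^ 32 = (Pn n : ℚ) := by
  have h := congrArg (fun l : List ℚ ↦ l[n]?) Ptab_spec
  simpa [List.getElem?_map, List.getElem?_range hn] using h

/-- `c_n = P_n/2³²` as reals, `n ≤ 100`. [cite: ConnesConsani2021, §6.4 display (opkf1) p. 24] -/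
theorem c_cast_eq {n : ℕ} (hn : n < 101) : ((CertAF.c n : ℚ) : ℝ) = (Pn n : ℝ) / 2 ^ 32 := by
  have h := c_mul_eq_Pn hn
  have h' : ((CertAF.c n * 2 ^ 32 : ℚ) : ℝ) = ((Pn n : ℚ) : ℝ) := by rw [h]
  push_cast at h'
  rw [← h']; ring

/-! ## §5 `innerSum`, `coefT`, `sigmaCoef` -/

/-- **`innerSum k j ∋ Σ_{m<100} cos^{(j)}(π(m+1)(2k+1)/128)·(P_{m+1}(m+1)^j)`.**
[cite: ConnesConsani2021, §6.4 display (opkf1) p. 24] -/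
theorem mem_innerSum (k j : ℕ) :
    MI.mem S (∑ m ∈ range 100,
        iteratedDeriv j Real.cos (π * (((m + 1) * (2 * k + 1) : ℕ) : ℝ) / 128) *
          ((Pn (m + 1) * ((m + 1 : ℕ) : ℤ) ^ j : ℤ) : ℝ)) (innerSum k j) := by
  unfold innerSum
  exact mem_sumMI 100 fun m _ ↦ MI.mem_mulInt (mem_trigAt_mul (m + 1) k j) _

/-- The real number enclosed by `coefT k j`: `2·Σ + [j = 0]·P₀`. [cite: ConnesConsani2021, §6.4 display (opkf1) p. 24] -/
theorem mem_coefT (k j : ℕ) :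
    MI.mem S ((∑ m ∈ range 100,
        iteratedDeriv j Real.cos (π * (((m + 1) * (2 * k + 1) : ℕ) : ℝ) / 128) *
          ((Pn (m + 1) * ((m + 1 : ℕ) : ℤ) ^ j : ℤ) : ℝ)) * ((2 : ℤ) : ℝ)
        + (if j = 0 then (Pn 0 : ℝ) else 0)) (coefT k j) := by
  unfold coefT
  have h2 := MI.mem_mulInt (mem_innerSum k j) 2
  by_cases hj : j = 0
  · simp only [hj, if_true]
    have h0 : MI.mem S ((Pn 0 : ℤ) : ℝ) (MI.ofInt S (Pn 0)) := MI.mem_ofInt S (Pn 0)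
    have := MI.mem_add (hj ▸ h2) h0
    simpa using this
  · simp only [hj, if_false, add_zero]
    exact h2

/-- The Taylor coefficient of t12's `abs_re_frameKernel_sub_taylor_le` at the centre `v_k`, times `2ẽ`,
rewritten over the integer data: for `L = log 2`, `v_k = (2k+1)L/128`,
`2ẽ·L⁻¹((δ_{j0}c₀ + 2Σ_{n=1}^{100} c_n (πn/L)^j cos^{(j)}(πn v_k/L))/j!)
 = [ (2Σ_{m<100} cos^{(j)}(π(m+1)(2k+1)/128)·P_{m+1}(m+1)^j + δ_{j0}P₀) · ((2ẽ/L)(π/L)^j/j!) ] / 2³²`.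
[cite: ConnesConsani2021, §6.4 display (opkf1) p. 24] -/
theorem coef_identity (k j : ℕ) :
    (twoEtNum : ℝ) / twoEtDen *
      ((Real.log 2 / 2 - -(Real.log 2 / 2))⁻¹ * ((if j = 0 then ((CertAF.c 0 : ℚ) : ℝ) else 0) +
        2 * ∑ n ∈ Finset.Icc 1 CertAF.N, ((CertAF.c n : ℚ) : ℝ) *
          (π * n / (Real.log 2 / 2 - -(Real.log 2 / 2))) ^ j *
            iteratedDeriv j Real.cos (π * n * ((2 * k + 1) * Real.log 2 / 128) /
              (Real.log 2 / 2 - -(Real.log 2 / 2)))) / (j.factorial : ℕ))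
    = ((∑ m ∈ range 100,
        iteratedDeriv j Real.cos (π * (((m + 1) * (2 * k + 1) : ℕ) : ℝ) / 128) *
          ((Pn (m + 1) * ((m + 1 : ℕ) : ℤ) ^ j : ℤ) : ℝ)) * ((2 : ℤ) : ℝ)
        + (if j = 0 then (Pn 0 : ℝ) else 0))
      * ((twoEtNum : ℝ) / twoEtDen * (Real.log 2)⁻¹ * (π * (Real.log 2)⁻¹) ^ j / (j.factorial : ℕ))
      / ((2 ^ 32 : ℕ) : ℝ) := by
  have hL : Real.log 2 / 2 - -(Real.log 2 / 2) = Real.log 2 := by ring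
  have hL0 : Real.log 2 ≠ 0 := (Real.log_pos one_lt_two).ne'
  rw [hL]
  -- the mode sum: `Icc 1 100` ↔ `range 100` shifted by one, `c_n = P_n/2³²`, angle `πn v_k/L = πn(2k+1)/128`
  have hN : CertAF.N = 100 := rfl
  have hsum : ∑ n ∈ Finset.Icc 1 CertAF.N, ((CertAF.c n : ℚ) : ℝ) * (π * n / Real.log 2) ^ j *
        iteratedDeriv j Real.cos (π * n * ((2 * k + 1) * Real.log 2 / 128) / Real.log 2)
      = (∑ m ∈ range 100,
          iteratedDeriv j Real.cos (π * (((m + 1) * (2 * k + 1) : ℕ) : ℝ) / 128) *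
            ((Pn (m + 1) * ((m + 1 : ℕ) : ℤ) ^ j : ℤ) : ℝ)) * (π * (Real.log 2)⁻¹) ^ j / 2 ^ 32 := by
    rw [hN, show Finset.Icc 1 100 = Finset.Ico 1 (100 + 1) from rfl, Finset.sum_Ico_eq_sum_range,
      Finset.sum_mul, Finset.sum_div]
    refine Finset.sum_congr rfl fun m hm ↦ ?_
    rw [show 1 + m = m + 1 from Nat.add_comm 1 m]
    have hm' : m + 1 < 101 := by rw [Finset.mem_range] at hm; omega
    rw [c_cast_eq hm']
    have hang : π * ((m + 1 : ℕ) : ℝ) * ((2 * k + 1) * Real.log 2 / 128) / Real.log 2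
        = π * (((m + 1) * (2 * k + 1) : ℕ) : ℝ) / 128 := by
      field_simp
      push_cast
      ring
    rw [hang]
    -- both sides are `D · P · (m+1)^j · π^j · L⁻¹^j / 2³²`
    generalize iteratedDeriv j Real.cos (π * (((m + 1) * (2 * k + 1) : ℕ) : ℝ) / 128) = Dj
    simp only [div_eq_mul_inv, mul_pow]
    push_cast
    ring
  rw [hsum]
  have hc0 : (if j = 0 then ((CertAF.c 0 : ℚ) : ℝ) else 0) = (if j = 0 then (Pn 0 : ℝ) else 0) / 2 ^ 32 := by
    split_ifs
    · rw [c_cast_eq (by norm_num)]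
    · simp
  rw [hc0]
  generalize (∑ m ∈ range 100,
      iteratedDeriv j Real.cos (π * (((m + 1) * (2 * k + 1) : ℕ) : ℝ) / 128) *
        ((Pn (m + 1) * ((m + 1 : ℕ) : ℤ) ^ j : ℤ) : ℝ)) = T
  have h2 : (2 : ℝ) ^ 32 ≠ 0 := by positivity
  have hfac : ((j.factorial : ℕ) : ℝ) ≠ 0 := by positivity
  by_cases hj : j = 0
  · subst hj
    simp only [if_true, pow_zero]
    push_cast
    field_simp
    ring
  · simp only [hj, if_false, zero_div, zero_add, add_zero]
    push_cast
    field_simp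
    ring

/-- **`sigmaCoef k j ∋ 2ẽ · a_j(v_k)`** with `a_j` the Taylor coefficient of `Re τ_c` at `v_k` in the
exact shape of `SpectralCert.abs_re_frameKernel_sub_taylor_le`. [cite: ConnesConsani2021, §6.4 display (opkf1) / Fact 6.1 p. 24] -/
theorem mem_sigmaCoef (k j : ℕ) :
    MI.mem S ((twoEtNum : ℝ) / twoEtDen *
      ((Real.log 2 / 2 - -(Real.log 2 / 2))⁻¹ * ((if j = 0 then ((CertAF.c 0 : ℚ) : ℝ) else 0) +
        2 * ∑ n ∈ Finset.Icc 1 CertAF.N, ((CertAF.c n : ℚ) : ℝ) *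
          (π * n / (Real.log 2 / 2 - -(Real.log 2 / 2))) ^ j *
            iteratedDeriv j Real.cos (π * n * ((2 * k + 1) * Real.log 2 / 128) /
              (Real.log 2 / 2 - -(Real.log 2 / 2)))) / (j.factorial : ℕ)))
      (sigmaCoef k j) := by
  rw [coef_identity]
  unfold sigmaCoef
  exact MI.mem_divNat (MI.mem_mul S_pos (mem_coefT k j) (mem_factor j)) (by positivity)

/-! ## §6 The global remainder `remI` -/

/-- `Σ_{m<100} |P_{m+1}|(m+1)¹³ = M13` as a real `Finset` sum. [cite: ConnesConsani2021, §6.4 display (opkf1) p. 24] -/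
theorem sum_abs_Pn_pow13 :
    ∑ m ∈ range 100, |(Pn (m + 1) : ℝ)| * ((m + 1 : ℕ) : ℝ) ^ 13 = (M13 : ℝ) := by
  have h := M13_spec
  have hl : (((List.range 100).map fun m ↦ |Pn (m + 1)| * ((m + 1 : ℕ) : ℤ) ^ 13).sum : ℤ)
      = ∑ m ∈ range 100, |Pn (m + 1)| * ((m + 1 : ℕ) : ℤ) ^ 13 := by
    rw [Finset.sum_eq_multiset_sum, Finset.range_val, Multiset.range, Multiset.map_coe, Multiset.sum_coe]
  rw [hl] at h
  have h' := congrArg (fun z : ℤ ↦ (z : ℝ)) h.symm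
  simpa only [Int.cast_sum, Int.cast_mul, Int.cast_abs, Int.cast_pow, Int.cast_natCast] using h'

/-- **The remainder constant is dominated by `remI`**:
`2ẽ · (|L⁻¹| · 2Σ_{n=1}^{100}|c_n||πn/L|¹³) · hQ¹³/13! · S ≤ remI`. [cite: ConnesConsani2021, §6.4 Fact 6.1 p. 24] -/
theorem remainder_le_remI :
    (twoEtNum : ℝ) / twoEtDen *
        (|(Real.log 2 / 2 - -(Real.log 2 / 2))⁻¹| *
          (2 * ∑ n ∈ Finset.Icc 1 CertAF.N, |((CertAF.c n : ℚ) : ℝ)| *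
            |π * n / (Real.log 2 / 2 - -(Real.log 2 / 2))| ^ (12 + 1))) *
        ((hQ : ℚ) : ℝ) ^ (12 + 1) / ((12 + 1).factorial : ℝ) * S ≤ (remI : ℝ) := by
  have hL : Real.log 2 / 2 - -(Real.log 2 / 2) = Real.log 2 := by ring
  have hL0 : 0 < Real.log 2 := Real.log_pos one_lt_two
  rw [hL]
  -- the MI number inside `remI`
  set X : MI := (((factor 13).mulInt (2 * (M13 : ℤ))).divNat (2 ^ 32)).mul S
    (MI.ofFrac S (5416 ^ 13) (10 ^ 78)) with hX
  have hremI : (remI : ℝ) = (X.hi : ℝ) + 1 := by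
    rw [show remI = X.hi + 1 from rfl, Int.cast_add, Int.cast_one]
  have hmem : MI.mem S
      (((twoEtNum : ℝ) / twoEtDen * (Real.log 2)⁻¹ * (π * (Real.log 2)⁻¹) ^ 13 / ((13).factorial : ℕ))
        * ((2 * (M13 : ℤ) : ℤ) : ℝ) / ((2 ^ 32 : ℕ) : ℝ) * ((((5416 ^ 13 : ℕ) : ℤ) : ℝ) / ((10 ^ 78 : ℕ) : ℝ))) X := by
    refine MI.mem_mul S_pos (MI.mem_divNat (MI.mem_mulInt (mem_factor 13) _) (by positivity)) ?_
    exact MI.mem_ofFrac S ((5416 ^ 13 : ℕ) : ℤ) (q := 10 ^ 78) (by positivity)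
  -- it IS the remainder constant
  have hN : CertAF.N = 100 := rfl
  have hsum : ∑ n ∈ Finset.Icc 1 CertAF.N, |((CertAF.c n : ℚ) : ℝ)| * |π * n / Real.log 2| ^ (12 + 1)
      = (∑ m ∈ range 100, |(Pn (m + 1) : ℝ)| * ((m + 1 : ℕ) : ℝ) ^ 13) *
          (π * (Real.log 2)⁻¹) ^ 13 / 2 ^ 32 := by
    rw [hN, show Finset.Icc 1 100 = Finset.Ico 1 (100 + 1) from rfl, Finset.sum_Ico_eq_sum_range,
      Finset.sum_mul, Finset.sum_div]
    refine Finset.sum_congr rfl fun m hm ↦ ?_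
    rw [show 1 + m = m + 1 from Nat.add_comm 1 m]
    have hm' : m + 1 < 101 := by rw [Finset.mem_range] at hm; omega
    rw [c_cast_eq hm', abs_div, abs_of_pos (by positivity : (0 : ℝ) < 2 ^ 32),
      abs_of_pos (by positivity : (0 : ℝ) < π * ((m + 1 : ℕ) : ℝ) / Real.log 2)]
    simp only [div_eq_mul_inv, mul_pow]
    ring
  have hval : (twoEtNum : ℝ) / twoEtDen *
        (|(Real.log 2)⁻¹| *
          (2 * ∑ n ∈ Finset.Icc 1 CertAF.N, |((CertAF.c n : ℚ) : ℝ)| * |π * n / Real.log 2| ^ (12 + 1))) *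
        ((hQ : ℚ) : ℝ) ^ (12 + 1) / ((12 + 1).factorial : ℝ)
      = ((twoEtNum : ℝ) / twoEtDen * (Real.log 2)⁻¹ * (π * (Real.log 2)⁻¹) ^ 13 / ((13).factorial : ℕ))
        * ((2 * (M13 : ℤ) : ℤ) : ℝ) / ((2 ^ 32 : ℕ) : ℝ) * ((((5416 ^ 13 : ℕ) : ℤ) : ℝ) / ((10 ^ 78 : ℕ) : ℝ)) := by
    rw [hsum, sum_abs_Pn_pow13, abs_of_pos (inv_pos.2 hL0)]
    have hq : ((hQ : ℚ) : ℝ) = (5416 : ℝ) / 10 ^ 6 := by norm_num [hQ]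
    rw [hq]
    push_cast
    ring
  rw [hval]
  have h1 := hmem.2
  rw [hremI]
  linarith

/-! ## §7 The Taylor models -/

/-- Horner evaluation of a `range`-indexed coefficient list. [folklore] -/
private theorem evalR_map_range (x : ℝ) :
    ∀ (n : ℕ) (f : ℕ → ℝ), evalR ((List.range n).map f) x = ∑ j ∈ range n, f j * x ^ j := by
  intro n
  induction n with
  | zero => intro f; simp
  | succ n ih =>
      intro f
      rw [List.range_succ_eq_map, List.map_cons, List.map_map, evalR_cons, ih, Finset.sum_range_succ',
        Finset.mul_sum, pow_zero, mul_one, add_comm]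
      congr 1
      exact Finset.sum_congr rfl fun j _ ↦ by simp only [Function.comp_apply, Nat.succ_eq_add_one, pow_succ]; ring

/-- `PMem` of two maps of one index list from pointwise membership. [folklore] -/
private theorem pmem_map {f : ℕ → ℝ} {F : ℕ → MI} (h : ∀ j, MI.mem S (f j) (F j)) :
    ∀ l : List ℕ, PMem S (l.map f) (l.map F)
  | [] => pmem_nil S
  | j :: l => pmem_cons (h j) (pmem_map h l)

/-- **Generic read-back of a «Taylor» model** (the shape of `sigmaTM`): a degree-`D` Taylor bound
`|f(w) − Σ_{j≤D} a_j w^j| ≤ C|w|^{D+1}/(D+1)!` on `|w| ≤ h`, coefficient enclosures `E·a_j ∈ P_j` and one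
scaled integer `rem ≥ E·C·h^{D+1}/(D+1)!·S` give `TMem S h (E·f) (P₀.widen rem :: P₁ … P_D)` (the remainder,
which depends on `w`, is absorbed in coefficient `0`). [cite: ConnesConsani2021, §6.4 Fact 6.1 p. 24 (the kernel certificate this serves)] -/
theorem tmem_of_taylor_bound {f : ℝ → ℝ} {a : ℕ → ℝ} {P : ℕ → MI} {E C : ℝ} {h : ℚ} {D : ℕ} {rem : ℤ}
    (hE : 0 ≤ E) (hC : 0 ≤ C)
    (htaylor : ∀ w : ℝ, |w| ≤ h →
      |f w - ∑ j ∈ range (D + 1), a j * w ^ j| ≤ C * |w| ^ (D + 1) / ((D + 1).factorial : ℝ))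
    (hP : ∀ j, MI.mem S (E * a j) (P j))
    (hrem : E * C * (h : ℝ) ^ (D + 1) / ((D + 1).factorial : ℝ) * S ≤ rem) :
    TMem S h (fun w ↦ E * f w) ((P 0).widen rem :: (List.range D).map (fun j ↦ P (j + 1))) := by
  intro w hw
  set R : ℝ := f w - ∑ j ∈ range (D + 1), a j * w ^ j with hR
  -- the remainder is within `rem/S` of `0`
  have hS0 : (0 : ℝ) ≤ S := by positivity
  have hwD : |w| ^ (D + 1) ≤ (h : ℝ) ^ (D + 1) := pow_le_pow_left₀ (abs_nonneg w) hw _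
  have hfac : (0 : ℝ) < ((D + 1).factorial : ℝ) := by positivity
  have hER : |E * a 0 + E * R - E * a 0| * S ≤ rem := by
    rw [add_sub_cancel_left, abs_mul, abs_of_nonneg hE]
    calc E * |R| * S ≤ E * (C * |w| ^ (D + 1) / ((D + 1).factorial : ℝ)) * S := by
          gcongr
          exact htaylor w hw
      _ ≤ E * (C * (h : ℝ) ^ (D + 1) / ((D + 1).factorial : ℝ)) * S := by
          gcongr
      _ = E * C * (h : ℝ) ^ (D + 1) / ((D + 1).factorial : ℝ) * S := by ring
      _ ≤ rem := hrem
  -- the coefficient list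
  let b : ℕ → ℝ := fun j ↦ if j = 0 then E * a 0 + E * R else E * a j
  refine ⟨b 0 :: (List.range D).map (fun j ↦ b (j + 1)), ?_, ?_⟩
  · refine pmem_cons ?_ (pmem_map (fun j ↦ ?_) _)
    · have h0 := MI.mem_widen (hP 0) (x' := E * a 0 + E * R) (e := rem) hER
      simpa [b] using h0
    · simpa [b] using hP (j + 1)
  · have hlist : b 0 :: (List.range D).map (fun j ↦ b (j + 1)) = (List.range (D + 1)).map b := by
      rw [List.range_succ_eq_map, List.map_cons, List.map_map]; rfl
    rw [hlist, evalR_map_range]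
    rw [Finset.sum_range_succ' (fun j ↦ b j * w ^ j)]
    simp only [b, Nat.succ_ne_zero, if_false, if_true, pow_zero, mul_one]
    have e1 : ∑ j ∈ range D, E * a (j + 1) * w ^ (j + 1) = E * ∑ j ∈ range D, a (j + 1) * w ^ (j + 1) := by
      rw [Finset.mul_sum]; exact Finset.sum_congr rfl fun j _ ↦ by ring
    have e2 : ∑ j ∈ range (D + 1), a j * w ^ j = ∑ j ∈ range D, a (j + 1) * w ^ (j + 1) + a 0 := by
      rw [Finset.sum_range_succ']; simp
    rw [e1, hR, e2]
    ring

/-- **K3 READ-BACK: `sigmaTM k` encloses `w ↦ 2ẽ·Re τ_c(v_k + w)` on `|w| ≤ hQ`**, for EVERY `k`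
(`v_k = (2k+1)·log 2/128`; `2ẽ = twoEtNum/twoEtDen`; `τ_c = frameKernel (−log 2/2) (log 2/2) N c`, the
certificate kernel of `SpectralCertCheck`).  Coefficients: `mem_sigmaCoef` = t12's explicit Taylor
coefficients; remainder: t12's global Lagrange bound `abs_re_frameKernel_sub_taylor_le` (degree 12)
folded into coefficient `0` (`remainder_le_remI`, `MI.mem_widen`).
[cite: ConnesConsani2021, §6.4 display (opkf1) / Fact 6.1 / Lemma 6.3 p. 24] -/
theorem tmem_sigmaTM (k : ℕ) :
    TMem S hQ (fun w ↦ (twoEtNum : ℝ) / twoEtDen *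
      (frameKernel (-(Real.log 2 / 2)) (Real.log 2 / 2) CertAF.N (fun n ↦ ((CertAF.c n : ℚ) : ℝ))
        ((2 * k + 1) * Real.log 2 / 128 + w)).re) (sigmaTM k) := by
  have hE : (0 : ℝ) ≤ (twoEtNum : ℝ) / twoEtDen := by unfold twoEtNum twoEtDen; positivity
  have hC : (0 : ℝ) ≤ |(Real.log 2 / 2 - -(Real.log 2 / 2))⁻¹| *
      (2 * ∑ n ∈ Finset.Icc 1 CertAF.N, |((CertAF.c n : ℚ) : ℝ)| *
        |π * n / (Real.log 2 / 2 - -(Real.log 2 / 2))| ^ (12 + 1)) := by positivity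
  have h := tmem_of_taylor_bound (D := 12) (h := hQ)
    (f := fun w ↦ (frameKernel (-(Real.log 2 / 2)) (Real.log 2 / 2) CertAF.N
      (fun n ↦ ((CertAF.c n : ℚ) : ℝ)) ((2 * k + 1) * Real.log 2 / 128 + w)).re)
    (a := fun j ↦ (Real.log 2 / 2 - -(Real.log 2 / 2))⁻¹ *
      ((if j = 0 then ((CertAF.c 0 : ℚ) : ℝ) else 0) +
        2 * ∑ n ∈ Finset.Icc 1 CertAF.N, ((CertAF.c n : ℚ) : ℝ) *
          (π * n / (Real.log 2 / 2 - -(Real.log 2 / 2))) ^ j *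
            iteratedDeriv j Real.cos (π * n * ((2 * k + 1) * Real.log 2 / 128) /
              (Real.log 2 / 2 - -(Real.log 2 / 2)))) / (j.factorial : ℕ))
    (P := fun j ↦ sigmaCoef k j) hE hC
    (fun w _ ↦ abs_re_frameKernel_sub_taylor_le (-(Real.log 2 / 2)) (Real.log 2 / 2) CertAF.N
      (fun n ↦ ((CertAF.c n : ℚ) : ℝ)) ((2 * k + 1) * Real.log 2 / 128) w 12)
    (fun j ↦ mem_sigmaCoef k j) remainder_le_remI
  exact h

/-- **The same in the frame's `2·ẽ` form** (`ẽ = 22996475683870528·10⁻¹⁵ = twoEtNum/(2·twoEtDen)`, the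
`et : ℚ` of `section6_enclosures_of_tier2`'s hypothesis `hM`): for every `k`,
`TMem S hQ (fun w ↦ 2·ẽ·Re τ_c(v_k + w)) (sigmaTM k)`.  (`ArchCert.S = ArchCertSigma.S = 2¹²⁸` and
`CertAF.N = 100` hold by `rfl`, so this is literally the (σ-sound) row of the cell's Tier-2 SPEC.)
[cite: ConnesConsani2021, §6.4 display (opkf1) / Fact 6.1 / Lemma 6.3 p. 24] -/
theorem tmem_sigmaTM_et (k : ℕ) :
    TMem S hQ (fun w ↦ 2 * ((22996475683870528 / 10 ^ 15 : ℚ) : ℝ) *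
      (frameKernel (-(Real.log 2 / 2)) (Real.log 2 / 2) CertAF.N (fun n ↦ ((CertAF.c n : ℚ) : ℝ))
        ((2 * k + 1) * Real.log 2 / 128 + w)).re) (sigmaTM k) := by
  have e : (2 : ℝ) * ((22996475683870528 / 10 ^ 15 : ℚ) : ℝ) = (twoEtNum : ℝ) / twoEtDen := by
    norm_num [twoEtNum, twoEtDen]
  simp_rw [e]
  exact tmem_sigmaTM k

/-- The (σ-sound) row in the SPEC's literal shape (`k < 64`, kernel with `N = 100`).
[cite: ConnesConsani2021, §6.4 display (opkf1) / Fact 6.1 / Lemma 6.3 p. 24] -/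
theorem tmem_sigmaTM_spec :
    ∀ k : ℕ, k < 64 → TMem S hQ (fun w ↦ 2 * ((22996475683870528 / 10 ^ 15 : ℚ) : ℝ) *
      (frameKernel (-(Real.log 2 / 2)) (Real.log 2 / 2) 100 (fun n ↦ ((CertAF.c n : ℚ) : ℝ))
        ((2 * k + 1) * Real.log 2 / 128 + w)).re) (sigmaTM k) :=
  fun k _ ↦ tmem_sigmaTM_et k

end Literature.NumberTheory.ConnesConsani2021.ArchCertSigma

end
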